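import Summits.QuantumFields.YangMills.Theorems.BalabanUVNodesN05SubBHKnitUniv
import Literature.MathematicalPhysics.QuantumFieldTheory.Balaban1983to89.Node00.Record13CarriersB8SubBHCoP

/-!
# BalabanUVNodes ∕ N05 ([B8], `Dag.B8_main`) AT THE STAGE-13 RECORD OF RECORD — PRINT'S BACKGROUND (v1.5 key `SepCo`), REPAIRED CARRIER ([B8″H] pin):
# the SLOT CLOSER at `Node00.IsRecordOfRecord₁₃CSepCoPSB8subBH` (+ same-datum `₁₃CSepCo` companion) and N05 in ∃-currency fed by the knit of record with THEOREM 8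
# DISPLAYED as one hypothesis `t8H` (the socket-agnostic face; the sourced-socket face is the sequel `…SubBHSepCoT8E`)

Track A of `YM-PLAN.md` (cell `pub-ymgap`, HUMAN RULING D-0062), node **N05** = [Balaban1985RegularSpaces] Lemma 1, Thm 2, Prop 3, Thm 4, Props 5–7, Thm 8; seat
`pub-ymgap-dag-n05-d` (g6), 2026-08-27; director-ym LINE №152 RULING (β) (RECORD 13 re-based at print's background `U_k(V)`) + R257 co-twin row C2 (dag-lead ORPHAN-STOREYS ∕
WORD-C2).  Inputs BY NAME: `Node00/Record13CarriersB8SubBHCoP` (this seat: the [B8″H] pin read at the Co Stage-5 view `toStage5₁₃CoP`, the v1.5-keyed one-pin S-record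
`IsRecordOfRecord₁₃CSepCoPSB8subBH`, companion, faces), `BalabanUVNodesN05SubBHKnitUniv.b8LeafOfRecordSubBH_cutSubB_zdLan_of_knit_lettersRDUB_univ_t8H` (this seat: the REPAIRED slot
`Node00.B8LeafOfRecordSubBH θ (λ.cutSubB J (zdLan ∘ ι) c₁)` from [4]'s letters ∕ b9 socket AT THE `Ω₀ = ℤᵈ` LAW MEMBERS ONLY, the `zdLan` letters (Prop. 5 ∃∕! discharged), Prop. 6 and
Prop. 7 displayed, and Theorem 8 surviving AT THE REPAIRED MEMBERS as ONE hypothesis `t8H` — p514768 RE-KEYED after the law-keyed `SB9all` binder and the cube sockets were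
certified unsatisfiable, `B8SockB9P3LawsBinderVacuity` ∕ `B8SockB9P3CubeBinderVacuity`).

WHY A NEW STOREY (and why the three U_old ₁₃ storeys of this lineage are NOT imaged — dag-lead WORD-C2, 2026-08-27T08:59:32Z).  `Thm/BalabanUVNodesN05AtRecord13SubB{,T8,T8B9}`
(p491938 ∕ p495958 ∕ p501054) conclude at the UN-REPAIRED pin `IsRecordOfRecord₁₃CSB8subB`, whose `b8` leaf `B8LeafOfRecordSubB θ λ` is certified EMPTY for every `λ`
(`B8LeafModelZd3SourceReality.not_b8LeafOfRecordSubB`, p501857; `Thm/BalabanUVNodesN05SlotVacuity`) — a background-FREE fact, so their KEY-RULE-21 images would be vacuous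
verbatim («located negatives and vacuous storeys are never twinned»).  The live N05 line is the REPAIRED one (`Node00/CarriersB8SubBH` → `Record13CarriersB8SubBH` → knits p514768 ∕
p515416); THIS FILE and its sequel are its ₁₃ storeys, born directly at the corrected key (v1.5 `Provisos₁₃SepCoP` ∕ `datumOfRecord₁₃SepCoP` ∕ `toStage5₁₃CoP`; KEY-RULE-21 R2 ∕ R5).

WHAT IS PROVED (composition BY NAME; no estimate; no new definition):
* §1 `exists_isRecordOfRecord₁₃CSepCoPSB8subBH_b8_of_leaf` — THE SLOT CLOSER at the record of record: ADMISSIBLE `θ : Stage13Params F N` WITH v1.5 PROVISOS `h`, a residual [B8]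
  layer `λ` and a proof of the repaired slot `B8LeafOfRecordSubBH θ.toStage3Params λ` give, for every window `γw ∈ ]0, θ.γ]`, worlds `w w′`: `IsRecordOfRecord₁₃CSepCoPSB8subBH F N
  (datumOfRecord₁₃SepCoP θ h) w` with its binding DISPLAYED (S-binding over the [B8″H]-pinned Co view), EVERY run's `b8` leaf and `Dag.B8_main (leavesP w P)`, and the same-datum
  companion `IsRecordOfRecord₁₃CSepCoP … w′` (leaves equal off `b8`; the companion's typed `b8` NOT claimed) — any knit of the slot plugs in by one token;
  `b8_main_at_isRecordOfRecord₁₃CSepCoPSB8subBH_of_forall_leaf` — the ∀-currency reading over the module's records.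
* §2 ★ **`exists_isRecordOfRecord₁₃CSepCoPSB8subBH_b8_of_knit_lettersRDUB_univ_t8H`** — §1 FED BY THE RE-KEYED KNIT: the knit's inputs AT `θ.toStage3Params` (record constants; [4]'s
  letters ∕ b9 socket at the `Ω₀ = ℤᵈ` law members and [4]'s letters at the Prop-5 members; the Prop.-5 index map `ι` with its three member laws; the printed members `p6` (at the
  cut constant `c₁`), `p7`, `t8H`) ⇒ for every `γw ∈ ]0, θ.γ]`, `∃ w w′` as in §1 at the CUT LAYER `λ.cutSubB J (zdLan ∘ ι) c₁`.
HONEST FRAMING: kernel bookkeeping by name; all sockets are HYPOTHESES (at `Ω₀ = ℤᵈ` members: no kernel refutation applies; satisfiability NOT claimed); `p6`, `p7` and `t8H` are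
HYPOTHESES = N05's own printed members NOT discharged here (the sequel `…SepCoT8Srv` knits `t8H` in from its sourced sockets); count-neutral; **N05 NOT discharged**; Bałaban AS PRINTED with locators; one finite 𝕋⁴ programme at fixed ε; nothing continuum ∕ ℝ⁴ ∕ OS ∕ mass-gap ∕ Clay.
No `sorry`, no new definition.  Unit `pub-ymgap-dag-n05-d` (g6), 2026-08-27.
[cite: Balaban1985RegularSpaces, Lemma 1 p.79, Thm 2 p.83, Prop. 3 p.87, Thm 4 p.88, Prop. 5 (1.107)–(1.109) p.94, Prop. 6 (1.131)–(1.138) pp.98–99; Prop. 7 p.100, Thm 8 (1.146) p.101 (named hypotheses); Balaban1985BackgroundPropagators, Thm 3.1 p.397, Thm 3.3 p.398, (3.25) p.394 (letters and b9 sockets, hypotheses); Balaban1989LargeFieldII, Thm 1 + (0.1) pp.355–356; Balaban1988Convergent, p.244, (2.12)–(2.13) pp.256–257 (the record at print's background, bookkeeping)]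
-/
noncomputable section

namespace Summit.QuantumFields.YangMills.BalabanUVNodes.N05AtRecord13SubBHSepCoP

open Literature.MathematicalPhysics.QuantumFieldTheory.Balaban1983to89
open Literature.MathematicalPhysics.QuantumFieldTheory.Balaban1983to89.Node00
open Literature.MathematicalPhysics.QuantumFieldTheory.Balaban1983to89.T4Continuum
open Literature.MathematicalPhysics.QuantumFieldTheory.Balaban1983to89.DagBinding
open Literature.MathematicalPhysics.QuantumFieldTheory.Balaban1983to89.B8IdxB8LawsB (towerBonds IdxB8LawsB IdxB8SubB famB8OfRecordSubB)
open Literature.MathematicalPhysics.QuantumFieldTheory.Balaban1983to89.B8LeafModelZd (ZdIdx)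
open Literature.MathematicalPhysics.QuantumFieldTheory.Balaban1983to89.B8LeafModelZd3 (SockB9P3)
open Literature.MathematicalPhysics.QuantumFieldTheory.Balaban1983to89.B8LeafModelZd3H (zdGF3H)
open Literature.MathematicalPhysics.QuantumFieldTheory.Balaban1983to89.B8SockLettersRD (SockLettersRD)
open Literature.MathematicalPhysics.QuantumFieldTheory.Balaban1983to89.B8Lemma1NonAbelian (mulCfg blockPairNA)
open Literature.MathematicalPhysics.QuantumFieldTheory.Balaban1983to89.B8Eq131CubesAdmissible (cubeFam)
open Literature.MathematicalPhysics.QuantumFieldTheory.Balaban1983to89.B8CubeMemberZd (cubeLamS cubeLamB)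
open Literature.MathematicalPhysics.QuantumFieldTheory.Balaban1983to89.B8Prop5LandauDataZd (ZdLanIdx zdLan)
open Summit.QuantumFields.YangMills.BalabanUVNodes.N05SubBHKnitUniv (b8LeafOfRecordSubBH_cutSubB_zdLan_of_knit_lettersRDUB_univ_t8H)
open MatrixLog B7Prop1Explicit B7Prop2Explicit B7Prop1Local B7Eq92Concrete
open B8Ineq130 (tlo thi)
open B8Ineq132 (InAk covDerivFwd)
open B7Eq78Linearization (zdBlocking QprimeIter)
open B8Eq119TwistedAxial (bgT Restr129 InAx)
open B8Eq140Level (SideTouches)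
open B8Eq138LandauZd (covLap QT InR138 IsLandau146W)
open B8Eq1117Concrete (XSpace)
open B8Prop5ContractionKLevel (Bd2)
open B8LambdaSpaceKLevel (wt)
open B8Eq184Proof (gaugeExp cfgExp)
open B8Eq146AExpansion (iEta)
open B7Prop4GeneralLevels (linCovIter)
open B8Eq155JBound (Jcur wsup)
open B8ScaledSupNorm (bondNorm msup Bdd)
open B8Thm2LogB (blockTop)

-- `Site` alone could resolve to the torus sites of `Setup.lean`; re-export the `ℤ^d` sites of `B7Prop1Explicit`.
export B7Prop1Explicit (Site)

/-! ## §1. The slot closer at the v1.5-keyed [B8″H] record (any proof of the repaired slot ⇒ N05 in ∃-currency at the record of record + companion) -/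

section Slot

variable {F : T4Family} {N : ℕ} [NeZero N]

/-- **THE SLOT CLOSER AT THE RECORD OF RECORD (v1.5 key, repaired carrier).**  ADMISSIBLE Stage-13 parameters `θ` WITH the v1.5 provisos `h`, a residual [B8] layer `lam` and a
proof of the REPAIRED slot `B8LeafOfRecordSubBH θ.toStage3Params lam` give, for every window `γw ∈ ]0, θ.γ]`, worlds `w w′` with: `IsRecordOfRecord₁₃CSepCoPSB8subBH F N
(datumOfRecord₁₃SepCoP θ h) w` (binding DISPLAYED: the S-binding over the [B8″H]-pinned Co Stage-13 view), EVERY run's `b8` leaf and `Dag.B8_main`, and the same-datum companion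
`IsRecordOfRecord₁₃CSepCoP … w′` (leaves equal off `b8`).  Pure bookkeeping over `Node00/Record13CarriersB8SubBHCoP`.
[cite: Balaban1985RegularSpaces, Lemma 1 – Thm 8 pp.79–101, Thm 8 (1.146) p.101 (the slot); Balaban1989LargeFieldII, Thm 1 + (0.1) pp.355–356 (the record, bookkeeping)] -/
theorem exists_isRecordOfRecord₁₃CSepCoPSB8subBH_b8_of_leaf (θ : Stage13Params F N) (h : θ.Provisos₁₃SepCoP F N) (hθ : θ.Admissible F N)
    (lam : ResidB8 θ.toStage3Params) (hleaf : B8LeafOfRecordSubBH θ.toStage3Params lam) {γw : ℝ} (hγ0 : 0 < γw) (hγ1 : γw ≤ θ.γ) :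
    ∃ w w' : WorldP, IsRecordOfRecord₁₃CSepCoPSB8subBH F N (datumOfRecord₁₃SepCoP F N θ h) w ∧
      w.C = (datumOfRecord₁₃SepCoP F N θ h).C ∧ w.γ = γw ∧ w.L = (θ.L : ℝ) ∧
      (∀ P : B12.RunParams, w.up P = upOfRecord₅CS F N ((θ.pinB8SubBH F N lam).toStage5₁₃CoP F N) P) ∧
      (∀ P : B12.RunParams, (leavesP w P).b8 ∧ Dag.B8_main (leavesP w P)) ∧
      IsRecordOfRecord₁₃CSepCoP F N (datumOfRecord₁₃SepCoP F N θ h) w' ∧ w'.C = w.C ∧ w'.γ = w.γ ∧ w'.L = w.L ∧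
      ∀ P : B12.RunParams, leavesP w P = { leavesP w' P with b8 := (leavesP w P).b8 } := by
  obtain ⟨w₀, -, -⟩ := exists_world_isRecordOfRecord₁₃CSepCoP F N θ h hθ ⟨hγ0, hγ1⟩
  have hrec : IsRecordOfRecord₁₃CSepCoPSB8subBH F N (datumOfRecord₁₃SepCoP F N θ h)
      { w₀ with
        C := (datumOfRecord₁₃SepCoP F N θ h).C, γ := γw, L := (θ.L : ℝ), one_lt_L := by exact_mod_cast θ.hL.2,
        up := fun P => upOfRecord₅CS F N ((θ.pinB8SubBH F N lam).toStage5₁₃CoP F N) P } :=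
    ⟨θ, h, lam, hθ, rfl, rfl, ⟨hγ0, hγ1⟩, rfl, fun _ => rfl⟩
  obtain ⟨w', hw', hC', hγ', hL', hleaves, -⟩ := companion_of_isRecordOfRecord₁₃CSepCoPSB8subBH hrec
  refine ⟨_, w', hrec, rfl, rfl, rfl, fun _ => rfl, fun P => ?_, hw', hC', hγ', hL', hleaves⟩
  have hb8 : (upOfRecord₅CS F N ((θ.pinB8SubBH F N lam).toStage5₁₃CoP F N) P).b8 :=
    (upOfRecord₅CS_toStage5₁₃CoP_pinB8SubBH_b8_iff F N θ lam P).2 hleaf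
  obtain ⟨h8iff, -, -⟩ := b8_b11_b10_main_iff_of_isRecordOfRecord₁₃CSepCoPSB8subBH hrec P
  exact ⟨hb8, h8iff.2 fun _ => hb8⟩

/-- **THE SLOT CLOSER, ∀-CURRENCY OVER THE MODULE'S RECORDS**: if the repaired slot holds at EVERY admissible v1.5 package, `Dag.B8_main` holds at every run of every record of
`IsRecordOfRecord₁₃CSepCoPSB8subBH` (instance of `b8_main_of_isRecordOfRecord₁₃CSepCoPSB8subBH_of_slot`). [cite: Balaban1985RegularSpaces, Thm 8 (1.146) p.101 (bookkeeping)] -/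
theorem b8_main_at_isRecordOfRecord₁₃CSepCoPSB8subBH_of_forall_leaf
    (hB : ∀ (θ : Stage13Params F N), θ.Provisos₁₃SepCoP F N → θ.Admissible F N → ∀ lam : ResidB8 θ.toStage3Params, B8LeafOfRecordSubBH θ.toStage3Params lam)
    {D : FiniteEpsData F (SU N)} {w : WorldP} (h : IsRecordOfRecord₁₃CSepCoPSB8subBH F N D w) (P : B12.RunParams) : Dag.B8_main (leavesP w P) :=
  b8_main_of_isRecordOfRecord₁₃CSepCoPSB8subBH_of_slot h (fun θ hP lam hθ _ _ => hB θ hP hθ lam) P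

end Slot

/-! ## §2. ★ N05 in ∃-currency at the v1.5-keyed [B8″H] Stage-13 record, FED BY THE RE-KEYED KNIT (sockets at `Ω₀ = ℤᵈ` members; `p6 p7 t8H` displayed) -/

section Record

variable {F : T4Family} {N : ℕ} [NeZero N]

/-- ★ **N05 IN ∃-CURRENCY AT THE STAGE-13 RECORD OF RECORD — print's background (v1.5 key), repaired carrier, sockets at the `Ω₀ = ℤᵈ` law members, Theorem 8 DISPLAYED**
(one-pin S-bound record + same-datum `₁₃CSepCo` companion).  ADMISSIBLE Stage-13 parameters `θ` WITH v1.5 PROVISOS `h` and the inputs of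
`BalabanUVNodesN05SubBHKnitUniv.b8LeafOfRecordSubBH_cutSubB_zdLan_of_knit_lettersRDUB_univ_t8H` AT `θ.toStage3Params` — record constants; [4]'s letters (`SLet`, `SLetUB`) and
the b9 socket (`SB9all`) at the `Ω₀ = ℤᵈ` LAW members, [4]'s letters at the Prop-5 members (`SLetL`, `SLetLU`); the Prop.-5 index map `ι` with its three member laws; the printed
members `p6` (Prop. 6 p. 99, at the cut constant `c₁`), `p7` (Prop. 7 p. 100) and `t8H` (Thm 8 p. 101, surviving at γ = 1 AT THE REPAIRED MEMBERS) — give, for every window `γw ∈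
]0, θ.γ]`, worlds `w w′`: `IsRecordOfRecord₁₃CSepCoPSB8subBH F N (datumOfRecord₁₃SepCoP θ h) w` with its binding DISPLAYED at the CUT LAYER `λ.cutSubB J (zdLan ∘ ι) c₁`, EVERY run's
`b8` leaf and `Dag.B8_main (leavesP w P)`, and the same-datum companion `IsRecordOfRecord₁₃CSepCoP … w′` (leaves equal off `b8`).  NOT a discharge of N05: `p6`, `p7`, `t8H`,
the letters families and the b9 socket are hypotheses.
[cite: Balaban1985RegularSpaces, Lemma 1 p.79, Thm 2 p.83, Prop. 3 p.87, Thm 4 p.88, Prop. 5 p.94; Prop. 6 p.99, Prop. 7 p.100, Thm 8 (1.146) p.101 (named hypotheses); Balaban1985BackgroundPropagators, Thm 3.1 p.397, Thm 3.3 p.398 (hypotheses); Balaban1989LargeFieldII, Thm 1 + (0.1) pp.355–356 (the record, bookkeeping)] -/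
theorem exists_isRecordOfRecord₁₃CSepCoPSB8subBH_b8_of_knit_lettersRDUB_univ_t8H (θ : Stage13Params F N) (h : θ.Provisos₁₃SepCoP F N) (hθ : θ.Admissible F N)
    (lam : ResidB8 θ.toStage3Params) (hD : 2 ≤ θ.toStage3Params.D)
    (hB₁' : lam.B₁' = 5 * (θ.toStage3Params.D : ℝ) * θ.toStage3Params.L * lam.inp.B₀)
    {cB9 B₀'H B₂' BG BR cL : ℝ} (hB : 2 ≤ 5 * (θ.toStage3Params.D : ℝ) * θ.toStage3Params.L * lam.inp.B₀) (hB₀β : 0 < lam.B₀β) (hC₂ : 2097152 * ((θ.toStage3Params.D : ℝ) + 1) ^ 2 ≤ lam.C₂)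
    (hcB9 : 0 < cB9) (hB₀'H : 0 < B₀'H) (hB₂' : 0 ≤ B₂') (hBG : 0 ≤ BG) (hBR : 0 ≤ BR) (hcL : 0 < cL)
    (hfree : 3 * (2 * (θ.toStage3Params.D : ℝ) * (θ.toStage3Params.L : ℝ) ^ 2) * BG * BR ≤ lam.inp.B₀')
    -- the two constant conditions of the Prop.-5 provider
    (hB₁2 : 2 ≤ lam.B₁) (hfree2 : 3 * (2 * (θ.toStage3Params.D : ℝ) * (θ.toStage3Params.L : ℝ) ^ 2) * BG * BR ≤ lam.inp.B₀' / 2)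
    -- [4]'s letters and the b9 socket AT THE `Ω₀ = ℤᵈ` LAW MEMBERS ONLY (= the sub-index of record `IdxB8SubB θ.toStage3Params`; the cube members are EXCLUDED): existence side (laws on print's domains) and uniqueness side
    (SLet : ∀ i : ZdIdx θ.toStage3Params.D θ.toStage3Params.L, i.Ω 0 = Set.univ → IdxB8LawsB θ.toStage3Params.L i → SockLettersRD (𝔸 := θ.toStage3Params.𝔸) θ.toStage3Params.L BG BR B₀'H B₂' cL i.η i.k i.Ω i.Λs)
    (SLetUB : ∀ i : ZdIdx θ.toStage3Params.D θ.toStage3Params.L, i.Ω 0 = Set.univ → IdxB8LawsB θ.toStage3Params.L i → ∀ α₀ : ℝ, 0 < α₀ → α₀ ≤ cL → ∀ U₀ : Site θ.toStage3Params.D → Fin θ.toStage3Params.D → θ.toStage3Params.𝔸ˣ, (∀ x κ, U₀ x κ ∈ unitaryUnits θ.toStage3Params.𝔸) →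
      InAk θ.toStage3Params.L i.k i.η α₀ i.Ω U₀ →
      ∃ (g Δ : (Site θ.toStage3Params.D → θ.toStage3Params.𝔸) →ₗ[ℂ] (Site θ.toStage3Params.D → θ.toStage3Params.𝔸)) (q : (Site θ.toStage3Params.D → θ.toStage3Params.𝔸) →ₗ[ℂ] (ℕ → Site θ.toStage3Params.D → θ.toStage3Params.𝔸))
        (qs : (ℕ → Site θ.toStage3Params.D → θ.toStage3Params.𝔸) →ₗ[ℂ] (Site θ.toStage3Params.D → θ.toStage3Params.𝔸)) (Aw c : (ℕ → Site θ.toStage3Params.D → θ.toStage3Params.𝔸) →ₗ[ℂ] (ℕ → Site θ.toStage3Params.D → θ.toStage3Params.𝔸))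
        (H' : XSpace θ.toStage3Params.D i.k θ.toStage3Params.𝔸 →ₗ[ℂ] (Site θ.toStage3Params.D → θ.toStage3Params.𝔸)),
        (∀ x : Site θ.toStage3Params.D → θ.toStage3Params.𝔸, (∃ C : ℝ, ∀ y, ‖x y‖ ≤ C) → g (Δ x + qs (Aw (q x))) = x) ∧ (∀ φ, qs (c (q (g (g (qs φ))))) = qs φ) ∧
        (∀ (f : Site θ.toStage3Params.D → θ.toStage3Params.𝔸), ∀ x ∈ i.Ω 0, Δ f x = covLap i.η U₀ ((i.Ω 0).indicator f) x) ∧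
        (∀ (μ : ℕ → Site θ.toStage3Params.D → θ.toStage3Params.𝔸), ∀ x ∈ i.Ω 0, qs μ x = QT θ.toStage3Params.L i.k (i.Λs i.k) U₀ μ x) ∧
        (∀ (f : Site θ.toStage3Params.D → θ.toStage3Params.𝔸) (n : ℕ), n ≤ i.k → ∀ y ∈ i.Λs i.k n, q f n y = QprimeIter (zdBlocking θ.toStage3Params.D θ.toStage3Params.L) (bgT θ.toStage3Params.L U₀) n f y) ∧
        (∀ (f : Site θ.toStage3Params.D → θ.toStage3Params.𝔸) (n : ℕ) (y : Site θ.toStage3Params.D), ¬ (n ≤ i.k ∧ y ∈ i.Λs i.k n) → q f n y = 0) ∧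
        (∀ (X : XSpace θ.toStage3Params.D i.k θ.toStage3Params.𝔸) (x : Site θ.toStage3Params.D), ‖H' X x‖ ≤ B₀'H * ‖X‖) ∧
        (∀ n, n ≤ i.k → ∀ (X : XSpace θ.toStage3Params.D i.k θ.toStage3Params.𝔸), ∀ p ∈ {b : Site θ.toStage3Params.D × Fin θ.toStage3Params.D | SideTouches (i.Ω n) b.1 b.2},
          wt θ.toStage3Params.L i.η n * ‖covDerivFwd i.η U₀ p.2 (H' X) p.1‖ ≤ B₀'H * ‖X‖) ∧
        (∀ X : XSpace θ.toStage3Params.D i.k θ.toStage3Params.𝔸, Bd2 θ.toStage3Params.L i.η i.k i.Ω (covLap i.η U₀ (H' X)) (B₂' * ‖X‖)) ∧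
        (∀ (Y : XSpace θ.toStage3Params.D i.k θ.toStage3Params.𝔸) (n : ℕ) (hn : n ≤ i.k) (y : Site θ.toStage3Params.D), y ∈ i.Λs i.k n →
          QprimeIter (zdBlocking θ.toStage3Params.D θ.toStage3Params.L) (bgT θ.toStage3Params.L U₀) n (H' Y) y = Y (⟨n, Nat.lt_succ_of_le hn⟩, y)) ∧
        (∀ (f : Site θ.toStage3Params.D → θ.toStage3Params.𝔸) (r : ℝ), 0 ≤ r → Bd2 θ.toStage3Params.L i.η i.k i.Ω f r →
          (∀ x, ‖g f x‖ ≤ BG * r) ∧ ∀ n, n ≤ i.k → ∀ p ∈ {b : Site θ.toStage3Params.D × Fin θ.toStage3Params.D | SideTouches (i.Ω n) b.1 b.2},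
            wt θ.toStage3Params.L i.η n * ‖covDerivFwd i.η U₀ p.2 (g f) p.1‖ ≤ BG * r) ∧
        (∀ (f : Site θ.toStage3Params.D → θ.toStage3Params.𝔸) (r : ℝ), 0 ≤ r → Bd2 θ.toStage3Params.L i.η i.k i.Ω f r → Bd2 θ.toStage3Params.L i.η i.k i.Ω (f - g (qs (c (q (g f))))) (BR * r)))
    (SB9all : ∀ i : ZdIdx θ.toStage3Params.D θ.toStage3Params.L, i.Ω 0 = Set.univ → IdxB8LawsB θ.toStage3Params.L i → ∀ m, m ≤ i.k →
      SockB9P3 (𝔸 := θ.toStage3Params.𝔸) θ.toStage3Params.L lam.inp.B₀ lam.B₀β cB9 lam.β lam.len i.η m i.Ω i.Λs i.Λb)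
    -- PROPOSITION 5's INDEX READ AS OBJECTS: `zdLan` members obeying the member laws, with [4]'s letters at each (RD currency)
    {J : Type} (ι : J → ZdLanIdx θ.toStage3Params.D θ.toStage3Params.𝔸)
    (hΩ0L : ∀ a : J, (ι a).Ω 0 = Set.univ) (hΩL : ∀ a : J, ∀ j, (ι a).Ω (j + 1) ⊆ (ι a).Ω j)
    (htowerL : ∀ a : J, ∀ j, j ≤ (ι a).k → ∀ y ∈ (ι a).Λ j, ∀ x, InBox (tlo θ.toStage3Params.L y j) (thi θ.toStage3Params.L y j) x → x ∈ (ι a).Ω j)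
    (SLetL : ∀ a : J, ∀ α₀ : ℝ, 0 < α₀ → α₀ ≤ cL → InAk θ.toStage3Params.L (ι a).k (ι a).η α₀ (ι a).Ω (ι a).U₀ →
      ∃ (g Δ : (Site θ.toStage3Params.D → θ.toStage3Params.𝔸) →ₗ[ℂ] (Site θ.toStage3Params.D → θ.toStage3Params.𝔸)) (q : (Site θ.toStage3Params.D → θ.toStage3Params.𝔸) →ₗ[ℂ] (ℕ → Site θ.toStage3Params.D → θ.toStage3Params.𝔸))
        (qs : (ℕ → Site θ.toStage3Params.D → θ.toStage3Params.𝔸) →ₗ[ℂ] (Site θ.toStage3Params.D → θ.toStage3Params.𝔸)) (Aw c : (ℕ → Site θ.toStage3Params.D → θ.toStage3Params.𝔸) →ₗ[ℂ] (ℕ → Site θ.toStage3Params.D → θ.toStage3Params.𝔸))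
        (H' : XSpace θ.toStage3Params.D (ι a).k θ.toStage3Params.𝔸 →ₗ[ℂ] (Site θ.toStage3Params.D → θ.toStage3Params.𝔸)),
        (∀ x, ∀ y ∈ (ι a).Ω 0, (Δ (g x) + qs (Aw (q (g x)))) y = x y) ∧ (∀ f, q (g (g (qs (c (q f))))) = q f) ∧
        (∀ (f : Site θ.toStage3Params.D → θ.toStage3Params.𝔸), ∀ x ∈ (ι a).Ω 0, Δ f x = covLap (ι a).η (ι a).U₀ (((ι a).Ω 0).indicator f) x) ∧
        (∀ (μ : ℕ → Site θ.toStage3Params.D → θ.toStage3Params.𝔸), ∀ x ∈ (ι a).Ω 0, qs μ x = QT θ.toStage3Params.L (ι a).k (ι a).Λ (ι a).U₀ μ x) ∧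
        (∀ (f : Site θ.toStage3Params.D → θ.toStage3Params.𝔸) (j : ℕ), j ≤ (ι a).k → ∀ y ∈ (ι a).Λ j, q f j y = QprimeIter (zdBlocking θ.toStage3Params.D θ.toStage3Params.L) (bgT θ.toStage3Params.L (ι a).U₀) j f y) ∧
        (∀ (X : XSpace θ.toStage3Params.D (ι a).k θ.toStage3Params.𝔸) (x : Site θ.toStage3Params.D), ‖H' X x‖ ≤ B₀'H * ‖X‖) ∧
        (∀ j, j ≤ (ι a).k → ∀ (X : XSpace θ.toStage3Params.D (ι a).k θ.toStage3Params.𝔸), ∀ p ∈ {b : Site θ.toStage3Params.D × Fin θ.toStage3Params.D | SideTouches ((ι a).Ω j) b.1 b.2},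
          wt θ.toStage3Params.L (ι a).η j * ‖covDerivFwd (ι a).η (ι a).U₀ p.2 (H' X) p.1‖ ≤ B₀'H * ‖X‖) ∧
        (∀ X : XSpace θ.toStage3Params.D (ι a).k θ.toStage3Params.𝔸, Bd2 θ.toStage3Params.L (ι a).η (ι a).k (ι a).Ω (covLap (ι a).η (ι a).U₀ (H' X)) (B₂' * ‖X‖)) ∧
        (∀ (X : XSpace θ.toStage3Params.D (ι a).k θ.toStage3Params.𝔸) (x : Site θ.toStage3Params.D), x ∉ (ι a).Ω 0 → H' X x = 0) ∧
        (∀ X Y : XSpace θ.toStage3Params.D (ι a).k θ.toStage3Params.𝔸, (∀ p, Y p = -star (X p)) → ∀ x, H' Y x = -star (H' X x)) ∧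
        (∀ (Y : XSpace θ.toStage3Params.D (ι a).k θ.toStage3Params.𝔸) (j : ℕ) (hj : j ≤ (ι a).k) (y : Site θ.toStage3Params.D), y ∈ (ι a).Λ j →
          QprimeIter (zdBlocking θ.toStage3Params.D θ.toStage3Params.L) (bgT θ.toStage3Params.L (ι a).U₀) j (H' Y) y = Y (⟨j, Nat.lt_succ_of_le hj⟩, y)) ∧
        (∀ (f : Site θ.toStage3Params.D → θ.toStage3Params.𝔸) (r : ℝ), 0 ≤ r → Bd2 θ.toStage3Params.L (ι a).η (ι a).k (ι a).Ω f r →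
          (∀ x, ‖g f x‖ ≤ BG * r) ∧ ∀ j, j ≤ (ι a).k → ∀ p ∈ {b : Site θ.toStage3Params.D × Fin θ.toStage3Params.D | SideTouches ((ι a).Ω j) b.1 b.2},
            wt θ.toStage3Params.L (ι a).η j * ‖covDerivFwd (ι a).η (ι a).U₀ p.2 (g f) p.1‖ ≤ BG * r) ∧
        (∀ (f : Site θ.toStage3Params.D → θ.toStage3Params.𝔸) (x : Site θ.toStage3Params.D), x ∉ (ι a).Ω 0 → g f x = 0) ∧
        (∀ f : Site θ.toStage3Params.D → θ.toStage3Params.𝔸, (∀ j, j ≤ (ι a).k → ∀ x ∈ (ι a).Ω j, IsSelfAdjoint (f x)) → ∀ x, IsSelfAdjoint (g f x)) ∧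
        (∀ (f : Site θ.toStage3Params.D → θ.toStage3Params.𝔸) (r : ℝ), 0 ≤ r → Bd2 θ.toStage3Params.L (ι a).η (ι a).k (ι a).Ω f r →
          Bd2 θ.toStage3Params.L (ι a).η (ι a).k (ι a).Ω (f - g (qs (c (q (g f))))) (BR * r)) ∧
        (∀ f : Site θ.toStage3Params.D → θ.toStage3Params.𝔸, (∀ j, j ≤ (ι a).k → ∀ x ∈ (ι a).Ω j, IsSelfAdjoint (f x)) →
          ∀ j, j ≤ (ι a).k → ∀ x ∈ (ι a).Ω j, IsSelfAdjoint ((f - g (qs (c (q (g f))))) x)))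
    -- [4]'s UNIQUENESS letters at the Prop-5 members (left-inverse law of G′ on bounded functions), for Prop. 5's uniqueness clause there
    (SLetLU : ∀ a : J, ∀ α₀ : ℝ, 0 < α₀ → α₀ ≤ cL → InAk θ.toStage3Params.L (ι a).k (ι a).η α₀ (ι a).Ω (ι a).U₀ →
      ∃ (g Δ : (Site θ.toStage3Params.D → θ.toStage3Params.𝔸) →ₗ[ℂ] (Site θ.toStage3Params.D → θ.toStage3Params.𝔸)) (q : (Site θ.toStage3Params.D → θ.toStage3Params.𝔸) →ₗ[ℂ] (ℕ → Site θ.toStage3Params.D → θ.toStage3Params.𝔸)) (qs : (ℕ → Site θ.toStage3Params.D → θ.toStage3Params.𝔸) →ₗ[ℂ] (Site θ.toStage3Params.D → θ.toStage3Params.𝔸))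
        (Aw c : (ℕ → Site θ.toStage3Params.D → θ.toStage3Params.𝔸) →ₗ[ℂ] (ℕ → Site θ.toStage3Params.D → θ.toStage3Params.𝔸)) (H' : XSpace θ.toStage3Params.D (ι a).k θ.toStage3Params.𝔸 →ₗ[ℂ] (Site θ.toStage3Params.D → θ.toStage3Params.𝔸)),
        (∀ x : Site θ.toStage3Params.D → θ.toStage3Params.𝔸, (∃ C : ℝ, ∀ y, ‖x y‖ ≤ C) → g (Δ x + qs (Aw (q x))) = x) ∧ (∀ φ, qs (c (q (g (g (qs φ))))) = qs φ) ∧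
        (∀ (f : Site θ.toStage3Params.D → θ.toStage3Params.𝔸), ∀ x ∈ (ι a).Ω 0, Δ f x = covLap (ι a).η (ι a).U₀ (((ι a).Ω 0).indicator f) x) ∧
        (∀ (μ : ℕ → Site θ.toStage3Params.D → θ.toStage3Params.𝔸), ∀ x ∈ (ι a).Ω 0, qs μ x = QT θ.toStage3Params.L (ι a).k (ι a).Λ (ι a).U₀ μ x) ∧
        (∀ (f : Site θ.toStage3Params.D → θ.toStage3Params.𝔸) (n : ℕ), n ≤ (ι a).k → ∀ y ∈ (ι a).Λ n, q f n y = QprimeIter (zdBlocking θ.toStage3Params.D θ.toStage3Params.L) (bgT θ.toStage3Params.L (ι a).U₀) n f y) ∧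
        (∀ (f : Site θ.toStage3Params.D → θ.toStage3Params.𝔸) (n : ℕ) (y : Site θ.toStage3Params.D), ¬ (n ≤ (ι a).k ∧ y ∈ (ι a).Λ n) → q f n y = 0) ∧
        (∀ (X : XSpace θ.toStage3Params.D (ι a).k θ.toStage3Params.𝔸) (x : Site θ.toStage3Params.D), ‖H' X x‖ ≤ B₀'H * ‖X‖) ∧
        (∀ n, n ≤ (ι a).k → ∀ (X : XSpace θ.toStage3Params.D (ι a).k θ.toStage3Params.𝔸), ∀ p ∈ {b : Site θ.toStage3Params.D × Fin θ.toStage3Params.D | SideTouches ((ι a).Ω n) b.1 b.2},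
          wt θ.toStage3Params.L (ι a).η n * ‖covDerivFwd (ι a).η (ι a).U₀ p.2 (H' X) p.1‖ ≤ B₀'H * ‖X‖) ∧
        (∀ X : XSpace θ.toStage3Params.D (ι a).k θ.toStage3Params.𝔸, Bd2 θ.toStage3Params.L (ι a).η (ι a).k (ι a).Ω (covLap (ι a).η (ι a).U₀ (H' X)) (B₂' * ‖X‖)) ∧
        (∀ (Y : XSpace θ.toStage3Params.D (ι a).k θ.toStage3Params.𝔸) (n : ℕ) (hn : n ≤ (ι a).k) (y : Site θ.toStage3Params.D), y ∈ (ι a).Λ n →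
          QprimeIter (zdBlocking θ.toStage3Params.D θ.toStage3Params.L) (bgT θ.toStage3Params.L (ι a).U₀) n (H' Y) y = Y (⟨n, Nat.lt_succ_of_le hn⟩, y)) ∧
        (∀ (f : Site θ.toStage3Params.D → θ.toStage3Params.𝔸) (r : ℝ), 0 ≤ r → Bd2 θ.toStage3Params.L (ι a).η (ι a).k (ι a).Ω f r →
          (∀ x, ‖g f x‖ ≤ BG * r) ∧ ∀ n, n ≤ (ι a).k → ∀ p ∈ {b : Site θ.toStage3Params.D × Fin θ.toStage3Params.D | SideTouches ((ι a).Ω n) b.1 b.2},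
            wt θ.toStage3Params.L (ι a).η n * ‖covDerivFwd (ι a).η (ι a).U₀ p.2 (g f) p.1‖ ≤ BG * r) ∧
        (∀ (f : Site θ.toStage3Params.D → θ.toStage3Params.𝔸) (r : ℝ), 0 ≤ r → Bd2 θ.toStage3Params.L (ι a).η (ι a).k (ι a).Ω f r →
          Bd2 θ.toStage3Params.L (ι a).η (ι a).k (ι a).Ω (f - g (qs (c (q (g f))))) (BR * r)))
    -- PROPOSITION 6 (displayed), PROPOSITION 7 and THEOREM 8 SURVIVING AT THE REPAIRED MEMBERS (hypotheses)
    -- PROPOSITION 6 on the record's cube family at the cut constant `c₁` (DISPLAYED: its cube-socket road `SLetC`∕`SB9C` is certified unsatisfiable, p508450)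
    (c₁ : ℝ) (p6 : B8.Prop6Printed θ.toStage3Params.D (θ.toStage3Params.L : ℝ) lam.B₁ c₁ (fun j : IdxB8SubB θ.toStage3Params => cubB8OfRecord θ.toStage3Params j.1))
    (p7 : B8SectGH.Prop7PrintedR (fun j : IdxB8SubB θ.toStage3Params => famB8OfRecordSubB θ.toStage3Params lam.β lam.len j) (fun j => lam.toAxial j.1))
    (t8H : B8Thm8Surviving.Thm8SurvivingAt 1 lam.B₁ lam.B₂ (fun j : IdxB8SubB θ.toStage3Params => famB8OfRecordSubBH θ.toStage3Params lam.β lam.len j))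
    {γw : ℝ} (hγ0 : 0 < γw) (hγ1 : γw ≤ θ.γ) :
    ∃ w w' : WorldP, IsRecordOfRecord₁₃CSepCoPSB8subBH F N (datumOfRecord₁₃SepCoP F N θ h) w ∧
      w.C = (datumOfRecord₁₃SepCoP F N θ h).C ∧ w.γ = γw ∧ w.L = (θ.L : ℝ) ∧
      (∀ P : B12.RunParams, w.up P =
        upOfRecord₅CS F N ((θ.pinB8SubBH F N (lam.cutSubB J (fun a : J => zdLan θ.toStage3Params.L lam.B₁ (ι a)) c₁)).toStage5₁₃CoP F N) P) ∧
      (∀ P : B12.RunParams, (leavesP w P).b8 ∧ Dag.B8_main (leavesP w P)) ∧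
      IsRecordOfRecord₁₃CSepCoP F N (datumOfRecord₁₃SepCoP F N θ h) w' ∧ w'.C = w.C ∧ w'.γ = w.γ ∧ w'.L = w.L ∧
      ∀ P : B12.RunParams, leavesP w P = { leavesP w' P with b8 := (leavesP w P).b8 } :=
  exists_isRecordOfRecord₁₃CSepCoPSB8subBH_b8_of_leaf θ h hθ _
    (b8LeafOfRecordSubBH_cutSubB_zdLan_of_knit_lettersRDUB_univ_t8H lam hD hB₁' hB hB₀β hC₂ hcB9 hB₀'H hB₂' hBG hBR hcL hfree hB₁2 hfree2 SLet SLetUB SB9all ι hΩ0L hΩL htowerL SLetL SLetLU c₁ p6 p7 t8H) hγ0 hγ1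

end Record

#print axioms exists_isRecordOfRecord₁₃CSepCoPSB8subBH_b8_of_leaf
#print axioms exists_isRecordOfRecord₁₃CSepCoPSB8subBH_b8_of_knit_lettersRDUB_univ_t8H

end Summit.QuantumFields.YangMills.BalabanUVNodes.N05AtRecord13SubBHSepCoP

end
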